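import Summits.BirchSwinnertonDyer.BirchSwinnertonDyer.Theses.ShaPrimaryTransfer
import Summits.BirchSwinnertonDyer.BirchSwinnertonDyer.Theorems.ShaPrimaryTransferOneFiniteShaComponentKernelDoors
import Summits.BirchSwinnertonDyer.BirchSwinnertonDyer.Theorems.ShaPrimaryTransferFiniteShaComponentTransferNonCMRankThreeDoor
import Literature.NumberTheory.EllipticCurves.XCubeSub82XShaTwo

/-!
# BirchSwinnertonDyer / ShaPrimaryTransfer — crux `FiniteShaComponentTransfer` (stmt-BirchSwinnertonDyer-22356):
# the door at 2 — T's hypothesis `t_2 = 0`, `corank Sel_{2^∞} = rank` — is open in the kernel at RANK 3,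
# on a CM curve (`y² = x³ − 82x`) and on a NON-CM curve (`y² = x³ + x² − 340x`)

Route `ShaPrimaryTransfer` (D-0145 LINE 2): T = `FiniteShaComponentTransfer` (stmt-22356: «`t_p(E) = 0 ⟹ t_q(E) = 0`»,
`t_p(E) = corank_{ℤ_p} Ш(E)[p^∞]`), O = `OneFiniteShaComponent` (stmt-22357: a door `t_{p₀}(E) = 0` at SOME prime). The
companion `…OneFiniteShaComponentKernelDoors` (g4) certified the door at `2` in the kernel at ranks `0, 1, 2` and recorded
«a rank-3 kernel door» as the next handle. This helper file (prover seat `bsd-line-spt-p1` g5, `--supports stmt-22356 --as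
helper`) supplies it twice, UNCONDITIONALLY (standard axioms, no named fact, no `L`-function):

* §1 CM (`j = 1728`): `E : y² = x³ − 82x` — Silverman, *AEC*, Remark X.6.1.1 / Exercise 10.18(a) («the curve with `p = 41`
  has rank `3`»): the tree's `mordellWeilRank_eq_three` and (new, `Literature/…/XCubeSub82XShaTwo`) `shaCorank_two_82`:
  `door_at_two_rank_three_82` (`rank = 3 ∧ t_2 = 0`), `oneFiniteShaComponent_82` (O for `E`), `hasCM_82`; read through T BY
  NAME: `shaCorank_82_eq_zero_of_transfer` (T ⟹ `t_q(E) = 0` ∀ `q`), `selmerCorank_82_eq_three_of_transfer` (T ⟹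
  `corank Sel_{q^∞}(E) = 3` ∀ `q`; at `q = 2` a tree theorem).
* §2 NON-CM: `W : y² = x³ + x² − 340x` (companion `…NonCMRankThreeDoor`: complete `2`-isogeny descent, `rank = 3`,
  `Ш(W)[2] = 0`, `j(W) ∉ ℤ`): `selmerCorank_340_eq_three_of_transfer` (T ⟹ `t_q(W) = 0 ∧ corank Sel_{q^∞}(W) = 3` ∀ `q`).
* §3 SYNTHESIS: **`exists_door_at_two_of_le_three`** — for every `r ≤ 3` an elliptic `E/ℚ` with `rank E(ℚ) = r` and
  `t_2(E) = 0`; `exists_transfer_hypothesis_of_le_three` (also `corank Sel_{2^∞} = r`: T's HYPOTHESIS is kernel-certified at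
  every rank ≤ 3, in `Ш`- and in Selmer coordinates); **`exists_nonCM_door_at_two_rank_three`** (a non-CM instance at rank 3);
  `transfer_conclusion_on_kernel_doors_le_three` (granting T: at every rank ≤ 3 some `E` with ALL `t_q(E) = 0` — certified
  unconditionally for no curve of rank ≥ 2).

So the route's instrument (descent at `2`) now reaches rank 3 in the kernel, inside and outside the CM sector; what remains
uncertified at rank ≥ 2 is exactly T's conclusion. Nothing here proves T, O or BSD; T is conjecture-grade at rank ≥ 2.
References: J. H. Silverman, *AEC* 2nd ed., X.6 Remark 6.1.1, Exercise 10.18(a), X.4.7, X.4.9; R. Greenberg, LNM 1716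
(1999), §1; J. H. Silverman, *ATAEC*, II.6.1.
-/

-- D-0017: single-problem summit, so `Summit.BirchSwinnertonDyer.BirchSwinnertonDyer.…` repeats a namespace BY DESIGN.
set_option linter.dupNamespace false

noncomputable section

namespace Summit.BirchSwinnertonDyer.BirchSwinnertonDyer.Theorems.ShaPrimaryTransferKernelRankThree

open scoped Classical
open Literature.NumberTheory.EllipticCurves Literature.NumberTheory.EllipticCurves.XCubeAddDX
open WeierstrassCurve WeierstrassCurve.Affine
open Summit.BirchSwinnertonDyer.BirchSwinnertonDyer.Theses.ShaPrimaryTransfer (FiniteShaComponentTransfer)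
open Summit.BirchSwinnertonDyer.BirchSwinnertonDyer.Theorems.ShaPrimaryTransferKernelDoors
open Summit.BirchSwinnertonDyer.BirchSwinnertonDyer.Theorems.ShaPrimaryTransferNonCMRankThree

/-! ## §1 The CM door at rank 3: `E : y² = x³ − 82x` (Silverman, AEC, Remark X.6.1.1 / Exercise 10.18(a)) -/

/-- **The door at 2 at rank 3 (CM, `j = 1728`): `rank E(ℚ) = 3` and `t_2(E) = 0`** for `E : y² = x³ − 82x` —
UNCONDITIONAL (tree: `mordellWeilRank_eq_three`, `shaCorank_two_82`; complete `2`-isogeny descent, no `L`-function).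
[cite: SilvermanAEC2009, Remark X.6.1.1 and Exercise 10.18(a)] -/
theorem door_at_two_rank_three_82 :
    (⟨0, 0, 0, -82, 0⟩ : WeierstrassCurve ℚ).mordellWeilRank = 3 ∧ (⟨0, 0, 0, -82, 0⟩ : WeierstrassCurve ℚ).shaCorank 2 = 0 :=
  ⟨mordellWeilRank_eq_three, shaCorank_two_82⟩

/-- **O holds for `E : y² = x³ − 82x`** (rank 3), witness `p₀ = 2`. UNCONDITIONAL. [cite: SilvermanAEC2009, Remark X.6.1.1] -/
theorem oneFiniteShaComponent_82 :
    ∃ (q : ℕ) (_ : Fact q.Prime), (⟨0, 0, 0, -82, 0⟩ : WeierstrassCurve ℚ).shaCorank q = 0 :=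
  ⟨2, ⟨Nat.prime_two⟩, shaCorank_two_82⟩

/-- `E : y² = x³ − 82x` has complex multiplication (`j = 1728`): the first rank-3 door lies in the CM sector (where
no printed `p`-converse reaches rank ≥ 2 either). [cite: SilvermanAEC2009, X.6 (E_D : y² = x³ + Dx has j = 1728)] -/
theorem hasCM_82 : (⟨0, 0, 0, -82, 0⟩ : WeierstrassCurve ℚ).HasCM := by
  haveI := isElliptic_82
  refine hasCM_of_j_eq_1728 _ ?_
  have hΔ : (⟨0, 0, 0, -82, 0⟩ : WeierstrassCurve ℚ).Δ = -64 * (-82 : ℚ) ^ 3 := by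
    norm_num [WeierstrassCurve.Δ, WeierstrassCurve.b₂, WeierstrassCurve.b₄, WeierstrassCurve.b₆,
      WeierstrassCurve.b₈]
  have hc₄ : (⟨0, 0, 0, -82, 0⟩ : WeierstrassCurve ℚ).c₄ = -48 * (-82 : ℚ) := by
    norm_num [WeierstrassCurve.c₄, WeierstrassCurve.b₂, WeierstrassCurve.b₄]
  rw [WeierstrassCurve.j, Units.val_inv_eq_inv_val, WeierstrassCurve.coe_Δ', hΔ, hc₄]
  norm_num

/-- **T at the rank-3 CM door**: granting T, `t_q(E) = 0` at EVERY prime `q` for `E : y² = x³ − 82x` (the door `t_2 = 0`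
transferred), i.e. `Ш(E/ℚ)` has trivial divisible part — which no theorem in print or in the tree gives for ANY curve of
rank ≥ 2. (Uses the crux BY NAME.) [cite: SilvermanAEC2009, Remark X.6.1.1] -/
theorem shaCorank_82_eq_zero_of_transfer (hT : FiniteShaComponentTransfer) (q : ℕ) [Fact q.Prime] :
    (⟨0, 0, 0, -82, 0⟩ : WeierstrassCurve ℚ).shaCorank q = 0 :=
  haveI := isElliptic_82
  haveI : Fact (Nat.Prime 2) := ⟨Nat.prime_two⟩
  hT _ 2 q shaCorank_two_82

/-- **T ⟹ `corank_{ℤ_q} Sel_{q^∞}(E/ℚ) = 3` at every prime `q`** for `E : y² = x³ − 82x` (Greenberg's identity; at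
`q = 2` this is the tree theorem `selmerCorank_two_82`, unconditionally). [cite: Greenberg1999LNM, §1 pp. 54–57] -/
theorem selmerCorank_82_eq_three_of_transfer (hT : FiniteShaComponentTransfer) (q : ℕ) [Fact q.Prime] :
    (⟨0, 0, 0, -82, 0⟩ : WeierstrassCurve ℚ).selmerCorank q = 3 := by
  haveI := isElliptic_82
  rw [(⟨0, 0, 0, -82, 0⟩ : WeierstrassCurve ℚ).selmerCorank_eq_mordellWeilRank_add_holds q, mordellWeilRank_eq_three,
    shaCorank_82_eq_zero_of_transfer hT q]

/-! ## §2 The NON-CM door at rank 3 (`W : y² = x³ + x² − 340x`, companion file `…NonCMRankThreeDoor`) read through T -/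

/-- **T at the NON-CM rank-3 door**: granting T, `t_q(W) = 0` and `corank Sel_{q^∞}(W/ℚ) = 3` at EVERY prime `q` for
`W : y² = x³ + x² − 340x` — the first cell of T at rank 3 outside the CM sector (uses the crux BY NAME; unconditional
at `q = 2`). [cite: Greenberg1999LNM, §1 pp. 54–57] -/
theorem selmerCorank_340_eq_three_of_transfer (hT : FiniteShaComponentTransfer) (q : ℕ) [Fact q.Prime] :
    (⟨0, 1, 0, -340, 0⟩ : WeierstrassCurve ℚ).shaCorank q = 0 ∧ (⟨0, 1, 0, -340, 0⟩ : WeierstrassCurve ℚ).selmerCorank q = 3 := by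
  haveI := isElliptic_340
  haveI : Fact (Nat.Prime 2) := ⟨Nat.prime_two⟩
  have h0 : (⟨0, 1, 0, -340, 0⟩ : WeierstrassCurve ℚ).shaCorank q = 0 := hT _ 2 q door_at_two_rank_three_340.2
  refine ⟨h0, ?_⟩
  rw [(⟨0, 1, 0, -340, 0⟩ : WeierstrassCurve ℚ).selmerCorank_eq_mordellWeilRank_add_holds q, mordellWeilRank_340_eq_three, h0]

/-! ## §3 Synthesis: the door at 2 is open in the kernel at every rank ≤ 3 -/

/-- **For every `r ≤ 3` there is an elliptic `E/ℚ` with `rank E(ℚ) = r` and `t_2(E) = 0`** — UNCONDITIONAL (`r ≤ 2`: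
the companion file's `exists_door_at_two_of_le_two`; `r = 3`: `y² = x³ − 82x`). [cite: SilvermanAEC2009, Cor. X.6.2.1 and Remark X.6.1.1] -/
theorem exists_door_at_two_of_le_three (r : ℕ) (hr : r ≤ 3) :
    ∃ W : WeierstrassCurve ℚ, W.IsElliptic ∧ W.mordellWeilRank = r ∧ W.shaCorank 2 = 0 := by
  rcases Nat.lt_or_ge r 3 with h | h
  · exact exists_door_at_two_of_le_two r (by omega)
  · obtain rfl : r = 3 := le_antisymm hr h
    exact ⟨_, isElliptic_82, door_at_two_rank_three_82⟩

/-- **T's hypothesis is kernel-certified at every rank ≤ 3, in both coordinates**: for every `r ≤ 3` an elliptic `E/ℚ` with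
`rank = r`, `corank_{ℤ_2} Sel_{2^∞}(E) = r` and `t_2(E) = 0`. UNCONDITIONAL. [cite: Greenberg1999LNM, §1 pp. 54–57] -/
theorem exists_transfer_hypothesis_of_le_three (r : ℕ) (hr : r ≤ 3) :
    ∃ W : WeierstrassCurve ℚ, W.IsElliptic ∧ W.mordellWeilRank = r ∧ W.selmerCorank 2 = r ∧ W.shaCorank 2 = 0 := by
  obtain ⟨W, hW, hrk, h2⟩ := exists_door_at_two_of_le_three r hr
  haveI := hW
  haveI : Fact (Nat.Prime 2) := ⟨Nat.prime_two⟩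
  refine ⟨W, hW, hrk, ?_, h2⟩
  rw [W.selmerCorank_eq_mordellWeilRank_add_holds 2, hrk, h2, add_zero]

/-- **A NON-CM rank-3 instance of T's hypothesis**: an elliptic `E/ℚ` without CM, of rank `3`, with `t_2(E) = 0` and
`corank Sel_{2^∞}(E) = 3` (`y² = x³ + x² − 340x`). UNCONDITIONAL. [cite: Greenberg1999LNM, §1] -/
theorem exists_nonCM_door_at_two_rank_three :
    ∃ W : WeierstrassCurve ℚ, W.IsElliptic ∧ ¬ W.HasCM ∧ W.mordellWeilRank = 3 ∧ W.selmerCorank 2 = 3 ∧ W.shaCorank 2 = 0 :=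
  ⟨_, isElliptic_340, not_hasCM_340, door_at_two_rank_three_340.1, selmerCorank_two_340, door_at_two_rank_three_340.2⟩

/-- **Under T, the door's consequence at every rank ≤ 3**: granting T, for every `r ≤ 3` some elliptic `E/ℚ` of rank `r`
has `t_q(E) = 0` at EVERY prime `q` (finite `Ш(E)[q^∞]` for all `q`); unconditionally the tree certifies this for no
curve of rank ≥ 2. [cite: Greenberg1999LNM, §1] -/
theorem transfer_conclusion_on_kernel_doors_le_three (hT : FiniteShaComponentTransfer) (r : ℕ) (hr : r ≤ 3) :
    ∃ W : WeierstrassCurve ℚ, W.IsElliptic ∧ W.mordellWeilRank = r ∧ ∀ (q : ℕ) [Fact q.Prime], W.shaCorank q = 0 := by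
  obtain ⟨W, hW, hrk, h2⟩ := exists_door_at_two_of_le_three r hr
  haveI := hW
  haveI : Fact (Nat.Prime 2) := ⟨Nat.prime_two⟩
  exact ⟨W, hW, hrk, fun q _ => hT W 2 q h2⟩

end Summit.BirchSwinnertonDyer.BirchSwinnertonDyer.Theorems.ShaPrimaryTransferKernelRankThree

end
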